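import Literature.AlgebraicGeometry.Resolution.WeightedCentreBottomEndgame
import Literature.AlgebraicGeometry.Resolution.WeightedCentreBottomExpand
import Literature.AlgebraicGeometry.Resolution.WeightedCentreBottomData
import Literature.AlgebraicGeometry.Resolution.WeightedCentreBottomDatum
import Literature.AlgebraicGeometry.Resolution.WeightedCentreUnipotentInverse
import HarnessLib

/-!
# Weighted centres — THEOREM A⁺ for the levels `2 ≤ r ≤ p − 1`, assembled from the eigen-relation

Instrument for engine 1's `W(f)` TOY MODEL (cell `pub-rosobs`, LF-MODEL-eng1-g45 §6.2 THEOREM A⁺, case `2 ≤ r ≤ p − 1`), NOT a resolution theorem and NOT about the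
invariant of [AbramovichTemkinWlodarczyk2024].

Given an element `x` of the bottom isotropy group already brought into EIGEN FORM by L2 (`EigenLift.eigen_lift_orbit(_exact)`: `x ∈ 𝔄_r`, `E_{μ₀}(x) = x^{n₀}·h`), fixing `g`,
moving a bottom slot `z` (minimal weight `w z = r`) by the pure term `c σ^r` with `c ≠ 0`, and `g` (P)-pinned at `z`, we derive `False`:
* `false_of_dvd` — `r ∣ p + 1`, `h ∈ 𝔄_{p+1}`: `ψ := aeval (slotData 𝔇 p u w a ((p+1)/r))` from `exists_expand_slots`;
* `false_of_three_le` — `3 ≤ r`, exact relation `E_{μ₀}(x) = x^{n₀}`: `ψ := exp_{<p}(T𝔇)` from `sigmaExp_eq_C_of_three_le`;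
both through the endgame `false_of_slotPinned_bottom` (kill coordinates + L7), with the gradedness of the `T`-coefficients checked here
(`isWeightedHomogeneous_coeff_sigmaExp_X`, `isWeightedHomogeneous_coeff_slotData`).  What remains for the full THEOREM A⁺ (g67): produce the eigen form from an arbitrary
element of `K = Stab(g) ∩ graded ∩ baseFixing ∩ 𝔄_1 ∩ Fix(V)` by L2 inside `K`, and the case `r = 1`.

References: [Lang2002, Ch. IV §1, Ch. XIII §4]; [Matsumura1987, §27]; [AbramovichTemkinWlodarczyk2024, §5.1 (p. 1575), Lemma 5.2.10 (p. 1577), Thm. 5.3.1 (2)–(3) (p. 1578)].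
-/

namespace Literature.AlgebraicGeometry.Resolution.WeightedBlowup.BottomClimb

open Polynomial OrderFiltration LevelProjection ZKernel EigenLift Truncation

section Weights

variable {k : Type*} [CommRing k] {ι : Type*} {p : ℕ} {u : ℕ → k} {w : ι → ℚ}

/-- `[T^n] exp_{<p}(T𝔇)(ε_i)` weighs `w i − n·θ` when `𝔇` has degree `−θ` (bookkeeping). [cite: AbramovichTemkinWlodarczyk2024, Lemma 5.2.10 (p. 1577); Matsumura1987, §27] -/
theorem isWeightedHomogeneous_coeff_sigmaExp_X {D : Derivation k (MvPolynomial ι k) (MvPolynomial ι k)} {θ : ℚ}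
    (hDX : ∀ i, MvPolynomial.IsWeightedHomogeneous w (D (MvPolynomial.X i)) (w i - θ)) (i : ι) (n : ℕ) :
    MvPolynomial.IsWeightedHomogeneous w ((sigmaExp D p u (MvPolynomial.X i)).coeff n) (w i - n • θ) := by
  rw [coeff_sigmaExp_X]
  split_ifs
  · rw [MvPolynomial.smul_eq_C_mul]
    have h := (MvPolynomial.isWeightedHomogeneous_C w (u n)).mul (TailedLightFlow.isWeightedHomogeneous_iterate_X D hDX i n)
    rwa [zero_add] at h
  · exact MvPolynomial.isWeightedHomogeneous_zero k w _

/-- `[T^n]` of the slot data weighs `w i − n·θ` when `𝔇` has degree `−θ`, `a_i` weighs `w i − (p+1)` and `q·θ = p + 1` (bookkeeping).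
[cite: AbramovichTemkinWlodarczyk2024, Lemma 5.2.10 (p. 1577)] -/
theorem isWeightedHomogeneous_coeff_slotData {D : Derivation k (MvPolynomial ι k) (MvPolynomial ι k)} {θ : ℚ}
    (hDX : ∀ i, MvPolynomial.IsWeightedHomogeneous w (D (MvPolynomial.X i)) (w i - θ)) {a : ι → MvPolynomial ι k}
    (ha : ∀ i, MvPolynomial.IsWeightedHomogeneous w (a i) (w i - ((p : ℚ) + 1))) {q : ℕ} (hq : (q : ℚ) * θ = (p : ℚ) + 1) (i : ι) (n : ℕ) :
    MvPolynomial.IsWeightedHomogeneous w ((slotData D p u w a q i).coeff n) (w i - n • θ) := by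
  unfold slotData
  split_ifs
  · rw [coeff_C]
    split_ifs with hn0
    · rw [hn0, zero_nsmul, sub_zero]
      exact MvPolynomial.isWeightedHomogeneous_X k w i
    · exact MvPolynomial.isWeightedHomogeneous_zero k w _
  · rw [coeff_add, Polynomial.coeff_C_mul_X_pow]
    refine (MvPolynomial.weightedHomogeneousSubmodule k w _).add_mem (isWeightedHomogeneous_coeff_sigmaExp_X hDX i n) ?_
    split_ifs with hnq
    · rw [hnq, nsmul_eq_mul, hq]
      exact ha i
    · exact MvPolynomial.isWeightedHomogeneous_zero k w _

end Weights

section APlus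

variable {k : Type*} [Field k] {ι : Type*} [Fintype ι] [DecidableEq ι] {w : ι → ℚ} {p : ℕ} [Fact p.Prime] [CharP k p] {u : ℕ → k}

/-- **THEOREM A⁺, case `r ∣ p + 1` (`2 ≤ r ≤ p − 1`), from the eigen form.**  `x` graded, base-fixing, fixing the slots of weight `> p+1`, `x ∈ 𝔄_r`,
`E_{μ₀}(x) = x^{n₀}·h` with `h ∈ 𝔄_{p+1}` of the same kind, `x(g) = g`, `x(ε_z) = ε_z + cσ^r` with `c ≠ 0` on a slot `z` of minimal weight `w z = r`, and `g` (P)-pinned at `z`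
⇒ `False` (`exists_expand_slots` ⇒ `ψ := aeval slotData` fixes `g`, moves `ε_z` by `cT`, is graded ⇒ `false_of_slotPinned_bottom`).  Instrument for engine 1's `W(f)` toy
model, NOT a resolution theorem. [cite: AbramovichTemkinWlodarczyk2024, §5.1 (p. 1575), Thm. 5.3.1 (2)–(3) (p. 1578); Lang2002, Ch. IV §1, Ch. XIII §4; Matsumura1987, §27] -/
theorem false_of_dvd (hu : ∀ n < p, (Nat.factorial n : k) * u n = 1) (hw : ∀ i, 0 ≤ w i)
    {x : (MvPolynomial ι k)[X] ≃+* (MvPolynomial ι k)[X]} (hxg : x ∈ graded w (1 : ℚ)) (hxb : x ∈ baseFixing)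
    (hxV : ∀ i, (p : ℚ) + 1 < w i → x (C (MvPolynomial.X i)) = C (MvPolynomial.X i)) {r : ℕ} (hr2 : 2 ≤ r) (hrp : r ≤ p - 1)
    (hl : x ∈ level (X : (MvPolynomial ι k)[X]) r) {μ₀ : (ZMod p)ˣ} (hμ₀ : orderOf μ₀ = p - 1) {n₀ : ℕ} (hn₀ : (n₀ : ZMod p) = (μ₀ : ZMod p) ^ r)
    {h : (MvPolynomial ι k)[X] ≃+* (MvPolynomial ι k)[X]} (hhg : h ∈ graded w (1 : ℚ)) (hhb : h ∈ baseFixing)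
    (hhV : ∀ i, (p : ℚ) + 1 < w i → h (C (MvPolynomial.X i)) = C (MvPolynomial.X i)) (hhl : h ∈ level (X : (MvPolynomial ι k)[X]) (p + 1))
    (hsx : scaleConj (castUnit p μ₀) x = x ^ n₀ * h) (hdiv : r ∣ p + 1) {g : MvPolynomial ι k} (hg : x (C g) = C g)
    {z : ι} (hmin : ∀ j, w z ≤ w j) (hwz : w z = r) {c : k} (hc : c ≠ 0)
    (hxz : x (C (MvPolynomial.X z)) = C (MvPolynomial.X z) + C (MvPolynomial.C c) * X ^ r) (hP : SlotPinned w z g) : False := by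
  have hp2 : 2 ≤ p := (Fact.out : p.Prime).two_le
  obtain ⟨a, ha, hxa⟩ := exists_expand_slots hu hw hxg hxb hxV hr2 hrp hl hμ₀ hn₀ hhg hhb hhV hhl hsx hdiv
  have hq1 : 1 ≤ (p + 1) / r := Nat.div_pos (by omega) (by omega)
  have hDX : ∀ i, MvPolynomial.IsWeightedHomogeneous w (projDer r x (MvPolynomial.X i)) (w i - w z) := fun i => by
    rw [hwz]; exact isWeightedHomogeneous_projDer hxg.1 r i
  have hq : (((p + 1) / r : ℕ) : ℚ) * w z = (p : ℚ) + 1 := by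
    rw [hwz]; exact_mod_cast Nat.div_mul_cancel hdiv
  have hP' : ∀ i, x (C (MvPolynomial.X i)) = Polynomial.expand (MvPolynomial ι k) r (slotData (projDer r x) p u w a ((p + 1) / r) i) :=
    fun i => by rw [hxa i]; rfl
  have hrp1 : (r : ℚ) + 1 ≤ p := by exact_mod_cast (show r + 1 ≤ p by omega)
  have haz : a z = 0 := UnipotentInverse.isWeightedHomogeneous_eq_zero_of_neg hw (ha z) (by rw [hwz]; linarith)
  refine false_of_slotPinned_bottom hw (MvPolynomial.aeval (slotData (projDer r x) p u w a ((p + 1) / r))) hmin (by rw [hwz]; exact_mod_cast (by omega : 0 < r))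
    (fun i => by rw [MvPolynomial.aeval_X]; exact coeff_zero_slotData hu (by omega) _ a hq1 i)
    (fun i n => by rw [MvPolynomial.aeval_X]; exact isWeightedHomogeneous_coeff_slotData hDX ha hq i n) hc ?_
    (aeval_eq_C_of_expand hxb.2 (by omega) hP' hg) hP
  rw [MvPolynomial.aeval_X, slotData_of_le _ a _ (by rw [hwz]; exact_mod_cast (by omega : r ≤ p + 1)), haz, map_zero, zero_mul, add_zero]
  exact sigmaExp_X_of_apply_eq_C hu hp2 (projDer_X_of_pure hxz)

/-- **THEOREM A⁺, case `3 ≤ r ≤ p − 1` with the EXACT eigen-relation, from the eigen form.**  As `false_of_dvd` but with `E_{μ₀}(x) = x^{n₀}` (L2 exact: the error `h` lies in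
`𝔄_{p+2} ∩ K = 1`) and no divisibility: `ψ := exp_{<p}(T𝔇)` (`sigmaExp_eq_C_of_three_le`) fixes `g`, moves `ε_z` by `cT`, is graded ⇒ `false_of_slotPinned_bottom`.  Instrument for
engine 1's `W(f)` toy model, NOT a resolution theorem. [cite: AbramovichTemkinWlodarczyk2024, §5.1 (p. 1575), Thm. 5.3.1 (2)–(3) (p. 1578); Lang2002, Ch. IV §1, Ch. XIII §4; Matsumura1987, §27] -/
theorem false_of_three_le (hu : ∀ n < p, (Nat.factorial n : k) * u n = 1) (hw : ∀ i, 0 ≤ w i)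
    {x : (MvPolynomial ι k)[X] ≃+* (MvPolynomial ι k)[X]} (hxg : x ∈ graded w (1 : ℚ)) (hxb : x ∈ baseFixing)
    (hxV : ∀ i, (p : ℚ) + 1 < w i → x (C (MvPolynomial.X i)) = C (MvPolynomial.X i)) {r : ℕ} (hr3 : 3 ≤ r) (hrp : r ≤ p - 1)
    (hl : x ∈ level (X : (MvPolynomial ι k)[X]) r) {μ₀ : (ZMod p)ˣ} (hμ₀ : orderOf μ₀ = p - 1) {n₀ : ℕ} (hn₀ : (n₀ : ZMod p) = (μ₀ : ZMod p) ^ r)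
    (hsx : scaleConj (castUnit p μ₀) x = x ^ n₀) {g : MvPolynomial ι k} (hg : x (C g) = C g)
    {z : ι} (hmin : ∀ j, w z ≤ w j) (hwz : w z = r) {c : k} (hc : c ≠ 0)
    (hxz : x (C (MvPolynomial.X z)) = C (MvPolynomial.X z) + C (MvPolynomial.C c) * X ^ r) (hP : SlotPinned w z g) : False := by
  have hp2 : 2 ≤ p := (Fact.out : p.Prime).two_le
  have hDX : ∀ i, MvPolynomial.IsWeightedHomogeneous w (projDer r x (MvPolynomial.X i)) (w i - w z) := fun i => by
    rw [hwz]; exact isWeightedHomogeneous_projDer hxg.1 r i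
  exact false_of_slotPinned_bottom hw (sigmaExp (projDer r x) p u) hmin (by rw [hwz]; exact_mod_cast (by omega : 0 < r))
    (coeff_zero_sigmaExp_X hu (by omega) _) (isWeightedHomogeneous_coeff_sigmaExp_X hDX) hc
    (sigmaExp_X_of_apply_eq_C hu hp2 (projDer_X_of_pure hxz)) (sigmaExp_eq_C_of_three_le hu hw hxg hxb hxV hr3 hrp hl hμ₀ hn₀ hsx hg) hP

end APlus

end Literature.AlgebraicGeometry.Resolution.WeightedBlowup.BottomClimb
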